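import Literature.MathematicalPhysics.QuantumFieldTheory.Balaban1983to89.B15Layer130Lattice
import Literature.MathematicalPhysics.QuantumFieldTheory.Balaban1983to89.B8Eq119TwistedAxial
import Literature.MathematicalPhysics.QuantumFieldTheory.Balaban1983to89.B15Bounds199

/-!
# `Balaban1983to89.B15Layer199Lattice` — [Balaban1989LargeFieldI] p. 199 (between (1.96) and (1.97)): the argument
# field `(1/i)log[M˙(U″_{k,Z})(M˙(U₀^{(AL)}))⁻¹]` on the layer `Σ` — *"This field can be bounded by
# 22d² max{1, L^{−2N}N^{1/2}O(1)B₃B₅M⁵(1 + β₀)}ε_h + 2δ′_k ≦ 22d²ε_h + 2(1 + β₀)N^{1/2}(A₁p₁(g_h))/(A₀p₀(g_h))ε_h <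
# 23d²ε_h"* — the FIRST MEMBER kernel-proved on the `ℤ^d` lattice carriers (two genuine fine fields: (1.65) of [14]
# with a general background + the logarithm), and the whole chain end-to-end with r12's located arithmetic

statement-level skeleton of published theorems with citation tags; proofs where landed; nothing here is a claim about the Yang–Mills mass gap

CITATION HEADER (lean-in-tree rule 2026-08-18).  T. Bałaban, *Large field renormalization. I. The basic step of the 𝐑
operation*, Commun. Math. Phys. **122** (1989) 175–202, doi:10.1007/BF01257412, bib `Balaban1989LargeFieldI` ("[IV]",
cell paper B15; PDF held `paper:balaban1989-cmp122-large-field-i`, journal page = PDF page + 174; p. 199 = PDF 25,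
p. 195 = PDF 21, p. 196 = PDF 22, READ AS IMAGES on the x2 renders
`run/shared/lean/pub/pub-balaban/b2b-balaban-ref1/pages/1989-cmp122-large-field-I/…-p021,p022,p025-x2.png`).  Its
reference [14] = T. Bałaban, *Spaces of regular gauge field configurations on a lattice and gauge fixing conditions*,
Commun. Math. Phys. **99** (1985) 75–102, bib `Balaban1985RegularSpaces` ((1.65) p. 87, (1.19) p. 79); [12] =
T. Bałaban, *Averaging operations for lattice gauge theories*, Commun. Math. Phys. **98** (1985) 17–51, bib
`Balaban1985Averaging` ((26) p. 22, Props. 1–2).  The paper is a manuscript under adjudication by the audit cell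
`pub-balaban`; NOTHING printed in it is used as a fact here: the sentence is PROVED as an implication from located
hypotheses on the tree's `ℤ^d` carriers.

WHAT IS REPRODUCED (mega-formalization `lit-balaban`, HOME `run/shared/lean/pub/lit-balaban/`, Phase-2 proof seat p29,
generation 7; SKELETON row **B15.Eq1.97** (the p. 199 passage; reader/fold owner r12, referee ref-5)): the first member
of the displayed chain (A) of p. 199 — the size of the argument field on the layer `Σ` — which r12's arithmetic
`B15Bounds199.chainA_le` / `chainA_lt` (p253777) takes as its starting real number and r12's
`B15HDecayLeaves.boundH199B_of_ineq190` (p257368) takes as the hypothesis `hm : ∀ y', bB.loc y' B ≤ 23d²ε_h`.  The two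
companion files of this seat, `B15Layer130Lattice` (p263483) and `B14ArgField36Lattice` (p264453), treat the argument
fields `(1/i)log[M˙(U)(M˙(Q^{s*}V))⁻¹]` whose background is a PULL-BACK tower; here BOTH fields are genuine fine
configurations (`U″_{k,Z}` and `U₀^{(AL)}`), so the mechanism is the printed (1.65) of [14] with a general background
`U₀` — the tree's `B8Ineq165Descent.ineq165_global` (p26): *"|(\overline{U′U₀})ʲ − Ū₀ʲ| < 11d²α₀ + α₁"* — followed by
the logarithm, (26) of [12] `|log X| ≤ 2|X − 1|` (`B15Layer130Lattice.norm_mlog_ratio_le`): `2·(11d²α₀ + α₁) =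
22d²α₀ + 2α₁`, which is the printed shape `22d²(max{1, X})ε_h + 2δ′_k` with `α₀ = max{1, X}ε_h`, `α₁ = δ′_k`.

THE PRINTED TEXT (p. 199 [PDF 25], verbatim).  *"Consider now the function U″_{k,Z} on the domain Ω^∼_{h+1}∩Ω^c_k. We
localize it in the domain Z∩Ω″^{∼2}_{h+1}, introducing the usual boundary conditions at the boundary ∂Ω″^{∼2}_{h+1}
through the determining set 𝔹_h(Ω″^{∼2}_{h+1}). We write the identity corresponding to (1.90), with 𝔹_h(□^{∼4}) replaced
by 𝔹″_{k,Z}∪𝔹_h(Ω″^{∼2}_{h+1}), and with the argument M˙(U″_{k,Z}) = [M˙(U″_{k,Z})(M˙(U₀^{(AL)}))⁻¹]M˙(U₀^{(AL)}). The above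
field is equal to V″ outside the layer of thickness 2M₁ (in L^{−h}-scale) at the boundary ∂Ω″^{∼2}_{h+1}. Denote this
layer by Σ. We expand the function with respect to (1/i)log[⋯]↾_Σ by the usual formula. This field can be bounded by
22d² max{1, L^{−2N}N^{1/2}O(1)B₃B₅M⁵(1 + β₀)}ε_h + 2δ′_k ≦ 22d²ε_h + 2(1 + β₀)N^{1/2}(A₁p₁(g_h))/(A₀p₀(g_h)) ε_h <
23d²ε_h."*  The inputs it names: (1.96) p. 199 *"|U″_{k,Z}(∂p) − 1| < ¾ε_h(L^{k−h}η)² … on the whole domain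
(Ω″^∼_{h+1})^c∩Ω_h"*; (1.80) p. 195 *"|U₀(∂p) − 1| < 2ε_kη² + O(1)B₃B₅M⁵exp(−δdist(p, Λ))ε_kη² for p ∈ Ω_k"* with p. 199
*"The plaquette variables of U₀^{ū₀} satisfy the estimate (1.80)"*; the units inequality (D) p. 199 *"ε_kη² ≦ (1 +
β₀)(k − j)^{1/2}L^{−2(k−j)}ε_j(L^{k−j}η)²"* (at `j = h`, `N = k − h`); (1.81)/(1.82) p. 195–196 *"V″ = V′V₀ on Λ₀, V₀ =
M_{𝔹″_k}(U₀). (1.81) … χ′ = χ({|B′(b)| < δ′_k for b∈𝔹₀}), (1.82) and V′ = exp iB′"* (the top-level closeness `2δ′_k`);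
and the smallness of `p₁/p₀` and the restriction on `N` ((1.94)) behind the last two members.

THE PROOF (the printed mechanism).  `§1` TWO FINE FIELDS: for `G`-valued `U₀`, `U` on the fine lattice below a tower
of `k` levels with `|U₀(∂p) − 1|, |U(∂p) − 1| < α₀ξ²` (`ξ = L^{−k}`), `α₀` Prop.-1/2-small ([12]), in the axial gauge of
`U` RELATIVE TO `U₀` on the cube tower ((1.19) [14]) and with `|Ūᵏ − Ū₀ᵏ| ≤ α₁` on the top cube ((1.35) [14] at the top
level), `11d²α₀ + α₁ ≤ 1/6` (Lemma 1 [14]): `ineq165_global` gives `|Ū^{k−n}_b − Ū₀^{k−n}_b| ≤ 8d²α₀(L^{−2(n−1)} + … +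
1) + α₁ < 11d²α₀ + α₁` at every depth `n` and bond `b` of the depth-`n` cube, and (26) of [12] doubles it:
`|(1/i)log[Ū^{k−n}_b(Ū₀^{k−n}_b)⁻¹]| ≤ 2(α₁ + 8d²α₀Σ) < 2α₁ + 22d²α₀` (`norm_argField2_le`, both orders of the ratio);
for EVERY pair of orbits the relative axial gauge EXISTS (the tree's certification of [14] p. 79,
`B8Eq119TwistedAxial.twistedFix_global`, `u = twGauge L U₀ U k y`), whence `norm_argField2_le_orbit`.  `§2` THE p. 199 INSTANCE: tower height `h` (the layer
`Σ` is measured *"in L^{−h}-scale"*: the top level is the `h`-th average, `ξ = L^{k−h}η = L^{−h}`), `U := U″_{k,Z}` with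
(1.96) `|U(∂p) − 1| < ¾ε_hξ²`, `U₀ := U₀^{ū₀}` with (1.80) in the form p. 199 uses it, `|U₀(∂p) − 1| < C·ε_kη²`
(`C` = the printed `O(1)B₃B₅M⁵`, absorbing (1.80)'s `2 + O(1)B₃B₅M⁵e^{−δdist}`), `η = L^{−k} = L^{−N}ξ`, and (D)
`ε_k ≤ (1+β₀)N^{1/2}ε_h`: then both fields satisfy `|·(∂p) − 1| < max{1, X}ε_hξ²` with the printed
`X = L^{−2N}N^{1/2}C(1+β₀)` (`¾ ≤ 1 ≤ max`, `Cε_kη² ≤ Xε_hξ² ≤ max{1,X}ε_hξ²`), and `§1` with `α₀ = max{1,X}ε_h`,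
`α₁ = δ′_k` ((1.81)/(1.82): `Ū^h(U″) = V″ = V′V₀ = V′Ū^h(U₀)` on the top blocks, `|V′ − 1| ≤ δ′_k`) gives the printed
first member `< 22d²max{1,X}ε_h + 2δ′_k` (`layer199_lt_max`); with the restriction `X ≤ 1` on `N` and `δ′_k ≤
(1+β₀)N^{1/2}(A₁p₁(g_h))/(A₀p₀(g_h))ε_h`, `2(1+β₀)N^{1/2}(A₁p₁/A₀p₀) < d²` (r12's `chainA_le`, `chainA_lt` BY NAME) the
whole chain `< 23d²ε_h` (`layer199_lt`), i.e. the `hm` of `boundH199B_of_ineq190` at the lattice level.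

DICTIONARY (as in `B8Ineq130` / `B8Ineq165Descent` / `B15Layer130Lattice`): every level is `ℤ^d`, the level below is
its `L`-fold refinement; level `j` ↦ depth `n = (top) − j`; `Ūʲ = avgIter L U j` ((43) of [12]) = the component `M^j`
of `M˙`; the cube tower `[tlo L lo n, thi L hi n]` below the top cube `[lo, hi]`; (1.19) of [14] in the transporter
form `Ūʲ(Γ_{Lz,x}) = Ū₀ʲ(Γ_{Lz,x})`, `x ∈ B(Lz)`; `|∂U − 1| < αξ²` ↦ `pdev U < α·((L^k)⁻¹)²`; values in an `AvgClosed`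
subgroup `G ≤ U1 𝔸` of a complete normed `ℂ`-algebra (`U(N)`, `SU(N)`: `B7Prop2Explicit`, `B7Prop2SpecialUnitary`);
`(1/i)log` ↦ `MatrixLog.mlog` (the norm is insensitive to the factor `1/i`).

HONEST SCOPE / DEVIATIONS.  (1) GLOBAL carriers: the regularity hypotheses are the global sup form on `ℤ^d` (print:
on `(Ω″^∼_{h+1})^c∩Ω_h`, resp. `Ω_k`); the conclusion is on the whole cube tower below the top cube, a superset of the
layer `Σ` (whose identification — *"equal to V″ outside the layer of thickness 2M₁"* — is the geometry of the
determining sets and is neither used nor asserted).  (2) The multi-level average `M˙` is taken componentwise (`M^{h−n}`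
at depth `n`), as in the companion files; nothing of the variational problems `U(𝔹, ·)`, of `ℍ`, of the gauge `(AL)` or
of `ū₀` is used — the file bounds the ARGUMENT of the expansion, which is what the sentence asserts.  (3) The top
closeness enters as the hypothesis `|Ū^h(U)_b(Ū^h(U₀)_b)⁻¹ − 1| ≤ δ′_k` on the top cube, the norm form of (1.81)/(1.82)
(`V″V₀⁻¹ = V′ = exp iB′`, `|B′(b)| < δ′_k`; for unitary matrices `|exp iB′ − 1| ≤ |B′|`); the relative axial gauge
(1.19) is a hypothesis on the pair in `layer199_lt_max` / `layer199_lt` (as (1.34) is in [14]) and is DISCHARGED for a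
gauge copy in the `_orbit` versions.  (4) Constants: `22 = 2·11` with [14]'s `11` (the descent gives `2·(32/3)`,
strict); `C` stands for the printed `O(1)B₃B₅M⁵` (one nonnegative real); `N^{1/2} = Real.sqrt (k − h)`; the flow
inequality (D) and the two located smallness facts of the last members are hypotheses, exactly as in r12's
`B15Bounds199`.  (5) Smallness ("for ε_h small": Props. 1/2 of [12], Lemma 1 of [14]) explicit on `α₀ = max{1,X}ε_h`:
`C₀α₀ ≤ ⅓`, `2α₀ ≤ c₂′`, `11d²α₀ + δ′_k ≤ 1/6`.  Every declaration is a proved theorem; no `def`, no new `Prop` fact;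
standard axioms.  Unit `lit-balaban-p29` (literature-prover-lit-balaban-p29-g7-0).
-/

noncomputable section

open scoped BigOperators
open NormedSpace Finset

namespace Literature.MathematicalPhysics.QuantumFieldTheory.Balaban1983to89.B15Layer199Lattice

open MatrixLog B7Prop1Explicit B7Prop2Explicit B8Lemma1NonAbelian B8Ineq129 B8Ineq130 B8Ineq165Descent
  B7AvgGaugeCovariance B8Eq115GaugeFixing B8Eq119TwistedAxial B15Layer130Lattice

-- `Site` alone would resolve to the torus sites of `Setup.lean`; re-export the `ℤ^d` sites of `B7Prop1Explicit`.
export B7Prop1Explicit (Site)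

variable {d : ℕ}

/-! ## §1 Two fine fields: (1.65) of [14] with a general background, followed by the logarithm -/

section TwoFields

variable {𝔸 : Type*} [NormedRing 𝔸] [NormOneClass 𝔸] [NormedAlgebra ℂ 𝔸] [CompleteSpace 𝔸]

/-- **THE ARGUMENT FIELD OF TWO FINE FIELDS**, `(1/i)log[M˙(U)(M˙(U₀))⁻¹]` componentwise: for `G`-valued `U₀`, `U`
below a tower of `k` levels with `|U₀(∂p) − 1|, |U(∂p) − 1| < α₀ξ²` (`ξ = L^{−k}`; (1.33)/(1.34) of [14]), `α₀`
Prop.-1/2-small, `U` in the axial gauge RELATIVE TO `U₀` on the cube tower ((1.19) of [14]), `|Ūᵏ_b − Ū₀ᵏ_b| ≤ α₁` on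
the top cube ((1.35) of [14]) and `11d²α₀ + α₁ ≤ 1/6`: at every depth `n ≤ k` and every bond `b = ⟨x, x + e_ν⟩` of the
depth-`n` cube, `|log[Ū^{k−n}_b(Ū₀^{k−n}_b)⁻¹]|, |log[Ū₀^{k−n}_b(Ū^{k−n}_b)⁻¹]| ≤ 2(α₁ + 8d²α₀(L^{−2(n−1)} + … + 1)) <
2α₁ + 22d²α₀` — (1.65) of [14] (`B8Ineq165Descent.ineq165_global`) and (26) of [12] (`norm_mlog_ratio_le`).
[cite: Balaban1989LargeFieldI, p.199 (after (1.96)); Balaban1985RegularSpaces, (1.65) p.87; Balaban1985Averaging, (26) p.22] -/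
theorem norm_argField2_le (L : ℕ) (hL : 2 ≤ L) (hd : 1 ≤ d) {G : Subgroup 𝔸ˣ} (hG : AvgClosed d L G) (k : ℕ)
    (U₀ U : Site d → Fin d → 𝔸ˣ) (hU₀ : ∀ x κ, U₀ x κ ∈ G) (hU : ∀ x κ, U x κ ∈ G)
    {α₀ α₁ : ℝ} (hα : 0 < α₀) (hα3 : C0 d * α₀ ≤ 1 / 3) (hα2 : 2 * α₀ ≤ c2' d L)
    (h33 : pdev U₀ < α₀ * (((L : ℝ) ^ k)⁻¹) ^ 2) (h34 : pdev U < α₀ * (((L : ℝ) ^ k)⁻¹) ^ 2)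
    (lo hi : Site d)
    (h19 : ∀ n, n < k → ∀ z, tlo L lo n ≤ z → z ≤ thi L hi n → ∀ r : Fin d → Fin L,
      axialFn (avgIter L U (k - (n + 1))) ((L : ℤ) • z) ((L : ℤ) • z + boxVec L r) =
        axialFn (avgIter L U₀ (k - (n + 1))) ((L : ℤ) • z) ((L : ℤ) • z + boxVec L r))
    (h35 : ∀ x ν, lo ≤ x → x + e ν ≤ hi →
      ‖((avgIter L U k x ν : 𝔸ˣ) : 𝔸) - avgIter L U₀ k x ν‖ ≤ α₁)
    (hα₁ : 0 ≤ α₁) (hsmall : 11 * (d : ℝ) ^ 2 * α₀ + α₁ ≤ 1 / 6)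
    (n : ℕ) (hn : n ≤ k) (x : Site d) (ν : Fin d) (hx : tlo L lo n ≤ x) (hxν : x + e ν ≤ thi L hi n) :
    ‖mlog (((avgIter L U (k - n) x ν * (avgIter L U₀ (k - n) x ν)⁻¹ : 𝔸ˣ) : 𝔸))‖ ≤
        2 * (α₁ + 8 * (d : ℝ) ^ 2 * α₀ * ∑ m ∈ Finset.range n, (((L : ℝ) ^ m)⁻¹) ^ 2) ∧
      ‖mlog (((avgIter L U₀ (k - n) x ν * (avgIter L U (k - n) x ν)⁻¹ : 𝔸ˣ) : 𝔸))‖ ≤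
        2 * (α₁ + 8 * (d : ℝ) ^ 2 * α₀ * ∑ m ∈ Finset.range n, (((L : ℝ) ^ m)⁻¹) ^ 2) ∧
      2 * (α₁ + 8 * (d : ℝ) ^ 2 * α₀ * ∑ m ∈ Finset.range n, (((L : ℝ) ^ m)⁻¹) ^ 2) <
        2 * α₁ + 22 * (d : ℝ) ^ 2 * α₀ := by
  obtain ⟨h1, h2⟩ := ineq165_global L hL hd hG k U₀ U hU₀ hU hα hα3 hα2 h33 h34 lo hi h19 h35 hα₁ hsmall n hn
    x ν hx hxν
  have hhalf : ‖((avgIter L U (k - n) x ν : 𝔸ˣ) : 𝔸) - avgIter L U₀ (k - n) x ν‖ ≤ 1 / 2 := by linarith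
  have hq : avgIter L U₀ (k - n) x ν ∈ U1 𝔸 :=
    hG.le_U1 (avgIter_mem L hL hG k U₀ hU₀ hα hα3 hα2 h33 (k - n) (Nat.sub_le k n) x ν)
  have hp : avgIter L U (k - n) x ν ∈ U1 𝔸 :=
    hG.le_U1 (avgIter_mem L hL hG k U hU hα hα3 hα2 h34 (k - n) (Nat.sub_le k n) x ν)
  exact ⟨(norm_mlog_ratio_le hq hhalf).trans (by linarith), (norm_mlog_ratio_le' hp hhalf).trans (by linarith),
    by linarith⟩

/-- **THE SAME FOR EVERY PAIR OF ORBITS** ([14] p. 79: *"The conditions (1.19) determine uniquely an element in each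
orbit"*, kernel-certified as `B8Eq119TwistedAxial.twistedFix_global`): for ANY `G`-valued `U₀`, `U` with the two
plaquette bounds (gauge invariant), the representative `U^{u}`, `u = twGauge L U₀ U k y` (the axial gauge of `U` relative
to `U₀`, normalised at `Lᵏy`), satisfies (1.19) relative to `U₀` between all consecutive levels, so the bound of
`norm_argField2_le` holds for the pair `U^{u}, U₀` given the top closeness of THAT pair — the argument field, like the
representation it comes from, is a statement about the gauge-fixed pair.
[cite: Balaban1989LargeFieldI, p.199 (after (1.96)); Balaban1985RegularSpaces, (1.19) p.79, (1.65) p.87] -/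
theorem norm_argField2_le_orbit (L : ℕ) (hL : 2 ≤ L) (hd : 1 ≤ d) {G : Subgroup 𝔸ˣ} (hG : AvgClosed d L G)
    (k : ℕ) (U₀ U : Site d → Fin d → 𝔸ˣ) (hU₀ : ∀ x κ, U₀ x κ ∈ G) (hU : ∀ x κ, U x κ ∈ G)
    {α₀ α₁ : ℝ} (hα : 0 < α₀) (hα3 : C0 d * α₀ ≤ 1 / 3) (hα2 : 2 * α₀ ≤ c2' d L)
    (h33 : pdev U₀ < α₀ * (((L : ℝ) ^ k)⁻¹) ^ 2) (h34 : pdev U < α₀ * (((L : ℝ) ^ k)⁻¹) ^ 2)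
    (y lo hi : Site d)
    (h35 : ∀ x ν, lo ≤ x → x + e ν ≤ hi →
      ‖((avgIter L (gaugeAct (twGauge L U₀ U k y) U) k x ν : 𝔸ˣ) : 𝔸) - avgIter L U₀ k x ν‖ ≤ α₁)
    (hα₁ : 0 ≤ α₁) (hsmall : 11 * (d : ℝ) ^ 2 * α₀ + α₁ ≤ 1 / 6)
    (n : ℕ) (hn : n ≤ k) (x : Site d) (ν : Fin d) (hx : tlo L lo n ≤ x) (hxν : x + e ν ≤ thi L hi n) :
    ‖mlog (((avgIter L (gaugeAct (twGauge L U₀ U k y) U) (k - n) x ν *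
        (avgIter L U₀ (k - n) x ν)⁻¹ : 𝔸ˣ) : 𝔸))‖ ≤
        2 * (α₁ + 8 * (d : ℝ) ^ 2 * α₀ * ∑ m ∈ Finset.range n, (((L : ℝ) ^ m)⁻¹) ^ 2) ∧
      ‖mlog (((avgIter L U₀ (k - n) x ν *
        (avgIter L (gaugeAct (twGauge L U₀ U k y) U) (k - n) x ν)⁻¹ : 𝔸ˣ) : 𝔸))‖ ≤
        2 * (α₁ + 8 * (d : ℝ) ^ 2 * α₀ * ∑ m ∈ Finset.range n, (((L : ℝ) ^ m)⁻¹) ^ 2) ∧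
      2 * (α₁ + 8 * (d : ℝ) ^ 2 * α₀ * ∑ m ∈ Finset.range n, (((L : ℝ) ^ m)⁻¹) ^ 2) <
        2 * α₁ + 22 * (d : ℝ) ^ 2 * α₀ := by
  have hL' : (0 : ℝ) < L := by exact_mod_cast lt_of_lt_of_le (by norm_num) hL
  have hdiv : α₀ / (L : ℝ) ^ 2 * (L : ℝ) ^ 2 = α₀ := div_mul_cancel₀ _ (pow_ne_zero 2 hL'.ne')
  have hβ : 0 < α₀ / (L : ℝ) ^ 2 := by positivity
  have hα3' : C0 d * (α₀ / (L : ℝ) ^ 2 * (L : ℝ) ^ 2) ≤ 1 / 3 := by rw [hdiv]; exact hα3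
  have hα2' : 2 * (α₀ / (L : ℝ) ^ 2 * (L : ℝ) ^ 2) ≤ c2' d L := by rw [hdiv]; exact hα2
  have h33' : pdev U₀ < α₀ / (L : ℝ) ^ 2 * (L : ℝ) ^ 2 * (((L : ℝ) ^ k)⁻¹) ^ 2 := by rwa [hdiv]
  have h34' : pdev U < α₀ / (L : ℝ) ^ 2 * (L : ℝ) ^ 2 * (((L : ℝ) ^ k)⁻¹) ^ 2 := by rwa [hdiv]
  obtain ⟨_, hU'G, hpdev, _, h19, _⟩ := twistedFix_global L hL hG k U₀ U hU₀ hU hβ hα3' hα2' h33' h34' y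
  have h34'' : pdev (gaugeAct (twGauge L U₀ U k y) U) < α₀ * (((L : ℝ) ^ k)⁻¹) ^ 2 := by rw [hpdev]; exact h34
  exact norm_argField2_le L hL hd hG k U₀ _ hU₀ hU'G hα hα3 hα2 h33 h34'' lo hi
    (fun n hn z _ _ r => h19 n hn z r) h35 hα₁ hsmall n hn x ν hx hxν

omit [NormedAlgebra ℂ 𝔸] [CompleteSpace 𝔸] in
/-- The top closeness in the PERTURBATION form of (1.81)/(1.82), `|V″_b(V₀)_b⁻¹ − 1| ≤ δ′` (`V″V₀⁻¹ = V′`), gives the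
difference form `|V″_b − V₀,b| ≤ δ′` used by (1.35) of [14] — the printed identity `|p − q| = |pq⁻¹ − 1|` of (1.65) for
a unit-norm `q` (`B8Ineq165Descent.norm_sub_le_norm_pert`). [cite: Balaban1989LargeFieldI, (1.81)-(1.82) p.195–196; Balaban1985RegularSpaces, (1.65) p.87] -/
theorem top_sub_le_of_pert {V V₀ : Site d → Fin d → 𝔸ˣ} (hV₀ : ∀ x κ, V₀ x κ ∈ U1 𝔸) {δ : ℝ} {lo hi : Site d}
    (h82 : ∀ x ν, lo ≤ x → x + e ν ≤ hi → ‖((V x ν * (V₀ x ν)⁻¹ : 𝔸ˣ) : 𝔸) - 1‖ ≤ δ)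
    (x : Site d) (ν : Fin d) (hx : lo ≤ x) (hxν : x + e ν ≤ hi) : ‖((V x ν : 𝔸ˣ) : 𝔸) - V₀ x ν‖ ≤ δ :=
  (norm_sub_le_norm_pert (hV₀ x ν)).trans (h82 x ν hx hxν)

end TwoFields

/-! ## §2 [IV] p. 199: the field on the layer `Σ`, `< 22d²max{1, X}ε_h + 2δ′_k ≦ … < 23d²ε_h` -/

section Page199

variable {𝔸 : Type*} [NormedRing 𝔸] [NormOneClass 𝔸] [NormedAlgebra ℂ 𝔸] [CompleteSpace 𝔸]

/-- Units bookkeeping of p. 199 (D) at `j = h`: `η = L^{−k} = L^{−N}ξ`, `ξ = L^{k−h}η = L^{−h}`, `N = k − h`: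
`(L^k)^{−2} = (L^{k−h})^{−2}·(L^h)^{−2}`. [cite: Balaban1989LargeFieldI, p.199 (inequality (D))] -/
theorem eta_sq_eq (L : ℕ) {h k : ℕ} (hhk : h ≤ k) :
    (((L : ℝ) ^ k)⁻¹) ^ 2 = (((L : ℝ) ^ (k - h)) ^ 2)⁻¹ * (((L : ℝ) ^ h)⁻¹) ^ 2 := by
  have hk : (L : ℝ) ^ k = (L : ℝ) ^ (k - h) * (L : ℝ) ^ h := by rw [← pow_add, Nat.sub_add_cancel hhk]
  rw [hk, mul_inv, mul_pow, inv_pow]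

omit [NormOneClass 𝔸] [NormedAlgebra ℂ 𝔸] [CompleteSpace 𝔸] in
/-- **(1.80) + (D) ⟹ the `X`-regularity of `U₀^{ū₀}` at the `h`-scale**: from `|U₀(∂p) − 1| < Cε_kη²` (the form in
which p. 199 uses (1.80), `C` = its `O(1)B₃B₅M⁵`), the flow inequality `ε_k ≤ (1+β₀)N^{1/2}ε_h` behind (D) and `C ≥ 0`:
`|U₀(∂p) − 1| < Xε_hξ²` with the printed `X = L^{−2N}N^{1/2}C(1+β₀)`, `ξ = L^{−h}`, `N = k − h`.
[cite: Balaban1989LargeFieldI, p.199 (max{1, L^{−2N}N^{1/2}O(1)B₃B₅M⁵(1+β₀)}), (1.80) p.195] -/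
theorem pdev_lt_X (L : ℕ) {h k : ℕ} (hhk : h ≤ k) (U₀ : Site d → Fin d → 𝔸ˣ) {εh εk C β₀ X : ℝ} (hC : 0 ≤ C)
    (h80 : pdev U₀ < C * εk * (((L : ℝ) ^ k)⁻¹) ^ 2)
    (hD : εk ≤ (1 + β₀) * Real.sqrt (k - h : ℕ) * εh)
    (hX : X = (((L : ℝ) ^ (k - h)) ^ 2)⁻¹ * Real.sqrt (k - h : ℕ) * C * (1 + β₀)) :
    pdev U₀ < X * εh * (((L : ℝ) ^ h)⁻¹) ^ 2 := by
  refine h80.trans_le ?_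
  rw [eta_sq_eq L hhk, hX]
  have hη : 0 ≤ (((L : ℝ) ^ (k - h)) ^ 2)⁻¹ * (((L : ℝ) ^ h)⁻¹) ^ 2 := by positivity
  have h1 : C * εk ≤ C * ((1 + β₀) * Real.sqrt (k - h : ℕ) * εh) := mul_le_mul_of_nonneg_left hD hC
  calc C * εk * ((((L : ℝ) ^ (k - h)) ^ 2)⁻¹ * (((L : ℝ) ^ h)⁻¹) ^ 2)
      ≤ C * ((1 + β₀) * Real.sqrt (k - h : ℕ) * εh) * ((((L : ℝ) ^ (k - h)) ^ 2)⁻¹ * (((L : ℝ) ^ h)⁻¹) ^ 2) :=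
        mul_le_mul_of_nonneg_right h1 hη
    _ = (((L : ℝ) ^ (k - h)) ^ 2)⁻¹ * Real.sqrt (k - h : ℕ) * C * (1 + β₀) * εh * (((L : ℝ) ^ h)⁻¹) ^ 2 := by
        ring

/-- **[IV] p. 199, THE FIRST MEMBER WITH THE PRINTED `max`** — *"This field can be bounded by 22d² max{1,
L^{−2N}N^{1/2}O(1)B₃B₅M⁵(1 + β₀)}ε_h + 2δ′_k"*.  On the `ℤ^d` carriers, tower of `h` levels (top = the `h`-th averages,
`ξ = L^{k−h}η = L^{−h}`, `η = L^{−k}`, `N = k − h`): `U` (= `U″_{k,Z}`) and `U₀` (= `U₀^{ū₀}`) `G`-valued with (1.96)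
`|U(∂p) − 1| < ¾ε_hξ²` and (1.80) `|U₀(∂p) − 1| < Cε_kη²`, (D) `ε_k ≤ (1+β₀)N^{1/2}ε_h`, `X := L^{−2N}N^{1/2}C(1+β₀)`,
`α₀ := max{1, X}ε_h` Prop.-1/2-small with `11d²α₀ + δ′_k ≤ 1/6`, `U` in the axial gauge relative to `U₀` on the cube
tower, and the top closeness (1.81)/(1.82) `|Ū^h(U)_b(Ū^h(U₀)_b)⁻¹ − 1| ≤ δ′_k` on the top cube `[lo, hi]`.  THEN at
every depth `n ≤ h` and every bond `b` of the depth-`n` cube: `|(1/i)log[M^{h−n}(U)_b(M^{h−n}(U₀)_b)⁻¹]| <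
22d²max{1, X}ε_h + 2δ′_k` (both orders of the ratio). [cite: Balaban1989LargeFieldI, p.199 (after (1.96)), (1.96) p.199, (1.80) p.195, (1.81)-(1.82) p.195–196] -/
theorem layer199_lt_max (L : ℕ) (hL : 2 ≤ L) (hd : 1 ≤ d) {G : Subgroup 𝔸ˣ} (hG : AvgClosed d L G)
    {h k : ℕ} (hhk : h ≤ k) (U₀ U : Site d → Fin d → 𝔸ˣ) (hU₀ : ∀ x κ, U₀ x κ ∈ G) (hU : ∀ x κ, U x κ ∈ G)
    {εh εk δk C β₀ X : ℝ} (hε : 0 < εh) (hC : 0 ≤ C) (hδ0 : 0 ≤ δk)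
    (h96 : pdev U < 3 / 4 * εh * (((L : ℝ) ^ h)⁻¹) ^ 2)
    (h80 : pdev U₀ < C * εk * (((L : ℝ) ^ k)⁻¹) ^ 2)
    (hD : εk ≤ (1 + β₀) * Real.sqrt (k - h : ℕ) * εh)
    (hX : X = (((L : ℝ) ^ (k - h)) ^ 2)⁻¹ * Real.sqrt (k - h : ℕ) * C * (1 + β₀))
    (hs3 : C0 d * (max 1 X * εh) ≤ 1 / 3) (hs2 : 2 * (max 1 X * εh) ≤ c2' d L)
    (hs6 : 11 * (d : ℝ) ^ 2 * (max 1 X * εh) + δk ≤ 1 / 6) (lo hi : Site d)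
    (h19 : ∀ n, n < h → ∀ z, tlo L lo n ≤ z → z ≤ thi L hi n → ∀ r : Fin d → Fin L,
      axialFn (avgIter L U (h - (n + 1))) ((L : ℤ) • z) ((L : ℤ) • z + boxVec L r) =
        axialFn (avgIter L U₀ (h - (n + 1))) ((L : ℤ) • z) ((L : ℤ) • z + boxVec L r))
    (h82 : ∀ x ν, lo ≤ x → x + e ν ≤ hi →
      ‖((avgIter L U h x ν * (avgIter L U₀ h x ν)⁻¹ : 𝔸ˣ) : 𝔸) - 1‖ ≤ δk)
    (n : ℕ) (hn : n ≤ h) (x : Site d) (ν : Fin d) (hx : tlo L lo n ≤ x) (hxν : x + e ν ≤ thi L hi n) :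
    ‖mlog (((avgIter L U (h - n) x ν * (avgIter L U₀ (h - n) x ν)⁻¹ : 𝔸ˣ) : 𝔸))‖ <
        22 * (d : ℝ) ^ 2 * max 1 X * εh + 2 * δk ∧
      ‖mlog (((avgIter L U₀ (h - n) x ν * (avgIter L U (h - n) x ν)⁻¹ : 𝔸ˣ) : 𝔸))‖ <
        22 * (d : ℝ) ^ 2 * max 1 X * εh + 2 * δk := by
  have hξ : 0 ≤ (((L : ℝ) ^ h)⁻¹) ^ 2 := by positivity
  have hmax : 1 ≤ max 1 X := le_max_left 1 X
  have hα : 0 < max 1 X * εh := by positivity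
  -- (1.96): `¾ε_h ≤ max{1,X}ε_h`
  have h34 : pdev U < max 1 X * εh * (((L : ℝ) ^ h)⁻¹) ^ 2 := by
    refine h96.trans_le (mul_le_mul_of_nonneg_right ?_ hξ)
    nlinarith
  -- (1.80) + (D): `Cε_kη² ≤ Xε_hξ² ≤ max{1,X}ε_hξ²`
  have h33 : pdev U₀ < max 1 X * εh * (((L : ℝ) ^ h)⁻¹) ^ 2 := by
    refine (pdev_lt_X L hhk U₀ hC h80 hD hX).trans_le (mul_le_mul_of_nonneg_right ?_ hξ)
    exact mul_le_mul_of_nonneg_right (le_max_right 1 X) hε.le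
  -- the top closeness in the difference form
  have hV₀ : ∀ x κ, avgIter L U₀ h x κ ∈ U1 𝔸 := fun x κ =>
    hG.le_U1 (avgIter_mem L hL hG h U₀ hU₀ hα hs3 hs2 h33 h le_rfl x κ)
  have h35 : ∀ x ν, lo ≤ x → x + e ν ≤ hi →
      ‖((avgIter L U h x ν : 𝔸ˣ) : 𝔸) - avgIter L U₀ h x ν‖ ≤ δk :=
    fun x ν hx hxν => top_sub_le_of_pert hV₀ h82 x ν hx hxν
  obtain ⟨h1, h2, h3⟩ := norm_argField2_le L hL hd hG h U₀ U hU₀ hU hα hs3 hs2 h33 h34 lo hi h19 h35 hδ0 hs6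
    n hn x ν hx hxν
  constructor <;> linarith

/-- **[IV] p. 199, THE WHOLE CHAIN** — *"… ≦ 22d²ε_h + 2(1 + β₀)N^{1/2}(A₁p₁(g_h))/(A₀p₀(g_h))ε_h < 23d²ε_h"*: under the
restriction `X ≤ 1` on `N` (so `max{1, X} = 1` and the regularity scale is `ε_h`), `δ′_k ≤ (1+β₀)N^{1/2}rε_h` (`r =
(A₁p₁(g_h))/(A₀p₀(g_h))`, p. 183 with the cumulated flow) and the located smallness `2(1+β₀)N^{1/2}r < d²` of `p₁/p₀` —
r12's `B15Bounds199.chainA_le` / `chainA_lt` BY NAME — the field of `layer199_lt_max` is `< 23d²ε_h` at every depth and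
bond of the cube tower: the hypothesis `hm` (`≤ 23d²ε_h`) of r12's `B15HDecayLeaves.boundH199B_of_ineq190` at the
lattice level. [cite: Balaban1989LargeFieldI, p.199 (after (1.96))] -/
theorem layer199_lt (L : ℕ) (hL : 2 ≤ L) (hd : 1 ≤ d) {G : Subgroup 𝔸ˣ} (hG : AvgClosed d L G)
    {h k : ℕ} (hhk : h ≤ k) (U₀ U : Site d → Fin d → 𝔸ˣ) (hU₀ : ∀ x κ, U₀ x κ ∈ G) (hU : ∀ x κ, U x κ ∈ G)
    {εh εk δk C β₀ X r : ℝ} (hε : 0 < εh) (hC : 0 ≤ C) (hδ0 : 0 ≤ δk)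
    (h96 : pdev U < 3 / 4 * εh * (((L : ℝ) ^ h)⁻¹) ^ 2)
    (h80 : pdev U₀ < C * εk * (((L : ℝ) ^ k)⁻¹) ^ 2)
    (hD : εk ≤ (1 + β₀) * Real.sqrt (k - h : ℕ) * εh)
    (hX : X = (((L : ℝ) ^ (k - h)) ^ 2)⁻¹ * Real.sqrt (k - h : ℕ) * C * (1 + β₀)) (hX1 : X ≤ 1)
    (hδ : δk ≤ (1 + β₀) * Real.sqrt (k - h : ℕ) * r * εh)
    (hsmall : 2 * (1 + β₀) * Real.sqrt (k - h : ℕ) * r < (d : ℝ) ^ 2)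
    (hs3 : C0 d * εh ≤ 1 / 3) (hs2 : 2 * εh ≤ c2' d L) (hs6 : 11 * (d : ℝ) ^ 2 * εh + δk ≤ 1 / 6)
    (lo hi : Site d)
    (h19 : ∀ n, n < h → ∀ z, tlo L lo n ≤ z → z ≤ thi L hi n → ∀ r : Fin d → Fin L,
      axialFn (avgIter L U (h - (n + 1))) ((L : ℤ) • z) ((L : ℤ) • z + boxVec L r) =
        axialFn (avgIter L U₀ (h - (n + 1))) ((L : ℤ) • z) ((L : ℤ) • z + boxVec L r))
    (h82 : ∀ x ν, lo ≤ x → x + e ν ≤ hi →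
      ‖((avgIter L U h x ν * (avgIter L U₀ h x ν)⁻¹ : 𝔸ˣ) : 𝔸) - 1‖ ≤ δk)
    (n : ℕ) (hn : n ≤ h) (x : Site d) (ν : Fin d) (hx : tlo L lo n ≤ x) (hxν : x + e ν ≤ thi L hi n) :
    ‖mlog (((avgIter L U (h - n) x ν * (avgIter L U₀ (h - n) x ν)⁻¹ : 𝔸ˣ) : 𝔸))‖ < 23 * (d : ℝ) ^ 2 * εh ∧
      ‖mlog (((avgIter L U₀ (h - n) x ν * (avgIter L U (h - n) x ν)⁻¹ : 𝔸ˣ) : 𝔸))‖ < 23 * (d : ℝ) ^ 2 * εh := by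
  have hm : max 1 X = 1 := max_eq_left hX1
  have hs3' : C0 d * (max 1 X * εh) ≤ 1 / 3 := by rw [hm, one_mul]; exact hs3
  have hs2' : 2 * (max 1 X * εh) ≤ c2' d L := by rw [hm, one_mul]; exact hs2
  have hs6' : 11 * (d : ℝ) ^ 2 * (max 1 X * εh) + δk ≤ 1 / 6 := by rw [hm, one_mul]; exact hs6
  obtain ⟨h1, h2⟩ := layer199_lt_max L hL hd hG hhk U₀ U hU₀ hU hε hC hδ0 h96 h80 hD hX hs3' hs2' hs6' lo hi h19
    h82 n hn x ν hx hxν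
  have hA := B15Bounds199.chainA_le (d := (d : ℝ)) (εh := εh) hX1 hδ
  have hB := B15Bounds199.chainA_lt (εh := εh) hsmall hε
  exact ⟨by linarith, by linarith⟩

/-- **[IV] p. 199 FOR EVERY PAIR OF ORBITS**: the chain `< 23d²ε_h` for the representative `U^{u}`, `u = twGauge L U₀ U h
y`, of ANY `G`-valued pair with (1.96)/(1.80) (gauge-invariant inputs) — the relative axial gauge (1.19) of [14] is
DISCHARGED by `B8Eq119TwistedAxial.twistedFix_global`; the top closeness (1.81)/(1.82) is, as in print, a restriction on
the gauge-fixed pair. [cite: Balaban1989LargeFieldI, p.199 (after (1.96)); Balaban1985RegularSpaces, (1.19) p.79] -/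
theorem layer199_lt_orbit (L : ℕ) (hL : 2 ≤ L) (hd : 1 ≤ d) {G : Subgroup 𝔸ˣ} (hG : AvgClosed d L G)
    {h k : ℕ} (hhk : h ≤ k) (U₀ U : Site d → Fin d → 𝔸ˣ) (hU₀ : ∀ x κ, U₀ x κ ∈ G) (hU : ∀ x κ, U x κ ∈ G)
    {εh εk δk C β₀ X r : ℝ} (hε : 0 < εh) (hC : 0 ≤ C) (hδ0 : 0 ≤ δk)
    (h96 : pdev U < 3 / 4 * εh * (((L : ℝ) ^ h)⁻¹) ^ 2)
    (h80 : pdev U₀ < C * εk * (((L : ℝ) ^ k)⁻¹) ^ 2)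
    (hD : εk ≤ (1 + β₀) * Real.sqrt (k - h : ℕ) * εh)
    (hX : X = (((L : ℝ) ^ (k - h)) ^ 2)⁻¹ * Real.sqrt (k - h : ℕ) * C * (1 + β₀)) (hX1 : X ≤ 1)
    (hδ : δk ≤ (1 + β₀) * Real.sqrt (k - h : ℕ) * r * εh)
    (hsmall : 2 * (1 + β₀) * Real.sqrt (k - h : ℕ) * r < (d : ℝ) ^ 2)
    (hs3 : C0 d * εh ≤ 1 / 3) (hs2 : 2 * εh ≤ c2' d L) (hs6 : 11 * (d : ℝ) ^ 2 * εh + δk ≤ 1 / 6)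
    (y lo hi : Site d)
    (h82 : ∀ x ν, lo ≤ x → x + e ν ≤ hi →
      ‖((avgIter L (gaugeAct (twGauge L U₀ U h y) U) h x ν * (avgIter L U₀ h x ν)⁻¹ : 𝔸ˣ) : 𝔸) - 1‖ ≤ δk)
    (n : ℕ) (hn : n ≤ h) (x : Site d) (ν : Fin d) (hx : tlo L lo n ≤ x) (hxν : x + e ν ≤ thi L hi n) :
    ‖mlog (((avgIter L (gaugeAct (twGauge L U₀ U h y) U) (h - n) x ν *
        (avgIter L U₀ (h - n) x ν)⁻¹ : 𝔸ˣ) : 𝔸))‖ < 23 * (d : ℝ) ^ 2 * εh ∧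
      ‖mlog (((avgIter L U₀ (h - n) x ν *
        (avgIter L (gaugeAct (twGauge L U₀ U h y) U) (h - n) x ν)⁻¹ : 𝔸ˣ) : 𝔸))‖ < 23 * (d : ℝ) ^ 2 * εh := by
  have hL' : (0 : ℝ) < L := by exact_mod_cast lt_of_lt_of_le (by norm_num) hL
  have hξ : 0 ≤ (((L : ℝ) ^ h)⁻¹) ^ 2 := by positivity
  -- both fields are `ε_h`-regular at the `h`-scale (`X ≤ 1`)
  have h34 : pdev U < εh * (((L : ℝ) ^ h)⁻¹) ^ 2 := by
    refine h96.trans_le (mul_le_mul_of_nonneg_right ?_ hξ)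
    linarith
  have h33 : pdev U₀ < εh * (((L : ℝ) ^ h)⁻¹) ^ 2 := by
    refine (pdev_lt_X L hhk U₀ hC h80 hD hX).trans_le (mul_le_mul_of_nonneg_right ?_ hξ)
    exact mul_le_of_le_one_left hε.le hX1
  -- the relative axial gauge EXISTS (twistedFix_global, stated with `α₀L²`)
  have hdiv : εh / (L : ℝ) ^ 2 * (L : ℝ) ^ 2 = εh := div_mul_cancel₀ _ (pow_ne_zero 2 hL'.ne')
  have hβ : 0 < εh / (L : ℝ) ^ 2 := by positivity
  have hα3' : C0 d * (εh / (L : ℝ) ^ 2 * (L : ℝ) ^ 2) ≤ 1 / 3 := by rw [hdiv]; exact hs3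
  have hα2' : 2 * (εh / (L : ℝ) ^ 2 * (L : ℝ) ^ 2) ≤ c2' d L := by rw [hdiv]; exact hs2
  have h33' : pdev U₀ < εh / (L : ℝ) ^ 2 * (L : ℝ) ^ 2 * (((L : ℝ) ^ h)⁻¹) ^ 2 := by rwa [hdiv]
  have h34' : pdev U < εh / (L : ℝ) ^ 2 * (L : ℝ) ^ 2 * (((L : ℝ) ^ h)⁻¹) ^ 2 := by rwa [hdiv]
  obtain ⟨_, hU'G, hpdev, _, h19, _⟩ := twistedFix_global L hL hG h U₀ U hU₀ hU hβ hα3' hα2' h33' h34' y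
  have h96' : pdev (gaugeAct (twGauge L U₀ U h y) U) < 3 / 4 * εh * (((L : ℝ) ^ h)⁻¹) ^ 2 := by
    rw [hpdev]; exact h96
  exact layer199_lt L hL hd hG hhk U₀ _ hU₀ hU'G hε hC hδ0 h96' h80 hD hX hX1 hδ hsmall hs3 hs2 hs6 lo hi
    (fun n hn z _ _ r => h19 n hn z r) h82 n hn x ν hx hxν

end Page199

end Literature.MathematicalPhysics.QuantumFieldTheory.Balaban1983to89.B15Layer199Lattice
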